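import Literature.Barriers.HodgeConjecture.GeneralizedHodgeTrivialReasonsDischarge

/-!
# Route `SecondaryPeriods`, crux `ConiveauOneFailure` (stmt-HodgeConjecture-3540): the HABITAT of
# the heart is inhabited — the calibration threefold `E_τ³`

The heart of the registered line of the crux (`stub_attractorPlane_offCurveCorrespondences`,
`Cruxes/ConiveauOneFailure/Lines/birth.lean`) asks for a smooth projective threefold `Y` with
`h^{3,0}(Y) = 1`, a finite set `s` of rational classes of `H³(Y(ℂ); ℂ)` whose span `V` is a sub-Hodge
structure (for a Hodge model `A`) of level one and of rank `2` — the HABITAT (a "rational rank-two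
attractor plane of a Calabi–Yau-type threefold") — such that no finite family of algebraic curve
correspondences carries `V` — the OBSTRUCTION (an open problem: a counterexample to GHC(3,1), hence
to the Hodge conjecture on `Y × E`).

This file proves that the habitat ALONE is inhabited, by the calibration threefold of Grothendieck's
1969 note: the cube `Y = E_τ³` of an elliptic curve, whose `H³` the tree knows completely
(`Grothendieck1969_ellipticCurveCubed_hodgeDecomposition_holds`: the twenty Künneth classes form a
`ℚ`-basis of the rational classes and a `ℂ`-basis, `H^{3,0} = ℂ · dv₀dv₁dv₂`,
`H^{2,1} ⊇ ⟨α_aβ_a ∧ (α_d + τβ_d)⟩`, `H^{1,2} ⊇ ⟨α_aβ_a ∧ (α_d + τ̄β_d)⟩`). The plane is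
`V = ⟨α₀β₀ ∧ α₁, α₀β₀ ∧ β₁⟩ = H²(E₀) ⊗ H¹(E₁) ⊗ H⁰(E₂) ≅ H¹(E)(−1)`: rational, of rank `2`, and
`V ⊗ ℂ = ℂ(α₀β₀ ∧ dv₁) ⊕ ℂ(α₀β₀ ∧ dv̄₁) ⊆ H^{2,1} ⊕ H^{1,2}`, while `h^{3,0}(E_τ³) = 1` because the
period functional `ℓ_{τ̄}` does not vanish on `dv₀dv₁dv₂` (`periodFunctional_prodClass`).

* `exists_levelOnePlane_calabiYauType_ellipticCurveCubed` — **the heart minus its obstruction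
  clause holds** (binders verbatim): the heart is not vacuous-false by habitat; its entire content
  is the obstruction. (At `E_τ³` the obstruction of course FAILS: `V` is the Gysin image of `H¹` of
  the divisor `{pt} × E × E`, so `E_τ³` is a calibration threefold of the route, kill criterion (c),
  not a witness.)
* `exists_levelOnePlane_threefold_ne_bot` — the same with "rank `2`" weakened to "non-zero": the
  hypotheses of the positive crux `LevelOneConiveauThreefolds` / `AttractorPlanesConiveauOne` are
  instantiated non-trivially in the tree (vacuity guard for both sides of the route).

## References

* [GrothendieckTopology1969] A. Grothendieck, Hodge's general conjecture is false for trivial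
  reasons, Topology 8 (1969), p. 300.
* [LangeBirkenhake1992] H. Lange, Ch. Birkenhake, Complex Abelian Varieties, §1.1.5 Thm. 1.1.21,
  Prop. 1.1.23.
* [CandelasEtAl2020] P. Candelas, X. de la Ossa, M. Elmi, D. van Straten, §6 (the habitat).
-/

noncomputable section

-- every declaration of this problem lives in `Summit.HodgeConjecture.HodgeConjecture.…` (summit = sub-problem), which `linter.dupNamespace` flags
set_option linter.dupNamespace false

namespace Summit.HodgeConjecture.HodgeConjecture.Theorems

open ComplexConjugate
open Literature.AlgebraicGeometry.Motives Literature.AlgebraicGeometry.HodgeTheory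
  Literature.AlgebraicTopology.SingularHomology
open Literature.Barriers.HodgeConjecture

/-- **The habitat of the heart of `ConiveauOneFailure` is inhabited (by `E_τ³`).** There is a smooth
projective threefold `Y` with a Hodge model `A` and a finite set `s` of rational classes of
`H³(Y(ℂ); ℂ)` such that the span of `s` is sub-Hodge (stable under the type decomposition of `A`),
of level one (inside `H^{2,1} ⊕ H^{1,2}`), `h^{3,0}(Y) = 1` and `dim span s = 2` — every clause of the
registered heart `stub_attractorPlane_offCurveCorrespondences` except the last (no curve
correspondence carries the plane). Witness: `Y = E_i³`, `s = {α₀β₀ ∧ α₁, α₀β₀ ∧ β₁}` in the Künneth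
basis of `Grothendieck1969_ellipticCurveCubed_hodgeDecomposition` (PROVED in the tree), for which
`α₀β₀ ∧ (α₁ + iβ₁) ∈ H^{2,1}` and `α₀β₀ ∧ (α₁ - iβ₁) ∈ H^{1,2}` span the complexified plane, and
`H^{3,0} = ℂ · dv₀dv₁dv₂ ≠ 0` by the period functional `ℓ_{-i}(dv₀dv₁dv₂) = -(-2i)³ ≠ 0`.
[cite: GrothendieckTopology1969, p. 300] [cite: LangeBirkenhake1992, §1.1.5 Thm. 1.1.21 and Prop. 1.1.23] -/
theorem exists_levelOnePlane_calabiYauType_ellipticCurveCubed :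
    ∃ (Y : SchemeOver ℂ) (_ : IsSmoothProjective 3 Y) (A : HodgeModel 3 Y)
      (s : Finset (complexBetti Y 3)),
      (∀ c ∈ s, IsRationalClass c) ∧
      (Submodule.span ℂ (↑s : Set (complexBetti Y 3))).map (A.pullback 3).hom =
        (⨆ (p : ℕ) (q : ℕ) (_ : p + q = 3),
          (Submodule.span ℂ (↑s : Set (complexBetti Y 3))).map (A.pullback 3).hom ⊓
            A.hodgePQ 3 p q) ∧
      (Submodule.span ℂ (↑s : Set (complexBetti Y 3))).map (A.pullback 3).hom ≤
        (⨆ (p : ℕ) (q : ℕ) (_ : p + q = 3) (_ : 1 ≤ p) (_ : 1 ≤ q), A.hodgePQ 3 p q) ∧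
      Module.finrank ℂ (A.hodgePQ 3 3 0) = 1 ∧
      Module.finrank ℂ (Submodule.span ℂ (↑s : Set (complexBetti Y 3))) = 2 := by
  classical
  -- the cube of `E_i` with its Künneth basis and Hodge pieces
  obtain ⟨X, hX, A, t, m, hrat, hli, hspan, h30, -, h21, h12⟩ :=
    Grothendieck1969_ellipticCurveCubed_hodgeDecomposition_holds Complex.I (by simp)
  set P : complexBetti X 3 →ₗ[ℂ] singularCohomology ℂ ℂ A.carrier 3 := (A.pullback 3).hom with hPdef
  have hP : ∀ x, A.pullback 3 x = P x := fun _ ↦ rfl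
  -- the pulled-back Künneth basis
  let B : Module.Basis (Fin 20) ℂ (singularCohomology ℂ ℂ A.carrier 3) :=
    Module.Basis.mk hli (by rw [hspan])
  have hB : ⇑B = kunnethFamily (fun S ↦ P (t S)) (fun a k i ↦ P (m a k i)) := by
    rw [Module.Basis.coe_mk]
    exact map_kunnethFamily P t m
  -- the plane: `f = (α₀β₀ ∧ α₁, α₀β₀ ∧ β₁) = (m 0 0 0, m 0 0 1)` = Künneth classes 8, 9
  let f : Fin 2 → complexBetti X 3 := ![m 0 0 0, m 0 0 1]
  have hf8 : kunnethFamily t m 8 = f 0 := by simp [kunnethFamily, f]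
  have hf9 : kunnethFamily t m 9 = f 1 := by simp [kunnethFamily, f]
  have hfli : LinearIndependent ℂ f := by
    refine LinearIndependent.of_comp P ?_
    have h := hli.comp ![(8 : Fin 20), 9] (by decide)
    convert h using 1
    funext i
    fin_cases i
    · simp [← hf8, hP]
    · simp [← hf9, hP]
  have hcoe : (↑(Finset.univ.image f) : Set (complexBetti X 3)) = Set.range f := by
    rw [Finset.coe_image, Finset.coe_univ, Set.image_univ]
  -- the two type-pure generators of the complexified plane: `α₀β₀ ∧ dv₁ ∈ H^{2,1}`, `α₀β₀ ∧ dv̄₁ ∈ H^{1,2}`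
  set u : singularCohomology ℂ ℂ A.carrier 3 := P (f 0) + Complex.I • P (f 1) with hu
  set v : singularCohomology ℂ ℂ A.carrier 3 := P (f 0) + conj Complex.I • P (f 1) with hv
  have hu21 : u ∈ A.hodgePQ 3 2 1 := by
    rw [h21]
    refine Submodule.subset_span (Or.inr ⟨(0, 0), ?_⟩)
    simp [hP, hu, f]
  have hv12 : v ∈ A.hodgePQ 3 1 2 := by
    rw [h12]
    refine Submodule.subset_span (Or.inr ⟨(0, 0), ?_⟩)
    simp [hP, hv, f]
  -- the complexified plane `W = P(span f)` contains `u`, `v` …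
  have hPf : ∀ i, P (f i) ∈ (Submodule.span ℂ (Set.range f)).map P := fun i ↦
    Submodule.mem_map_of_mem (Submodule.subset_span (Set.mem_range_self i))
  have huW : u ∈ (Submodule.span ℂ (Set.range f)).map P :=
    Submodule.add_mem _ (hPf 0) (Submodule.smul_mem _ _ (hPf 1))
  have hvW : v ∈ (Submodule.span ℂ (Set.range f)).map P :=
    Submodule.add_mem _ (hPf 0) (Submodule.smul_mem _ _ (hPf 1))
  -- … and is generated by them (`i ≠ -i`)
  have key : ∀ R : Submodule ℂ (singularCohomology ℂ ℂ A.carrier 3), u ∈ R → v ∈ R →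
      (Submodule.span ℂ (Set.range f)).map P ≤ R := by
    intro R huR hvR
    have h1 : P (f 1) ∈ R := by
      have hdiff : u - v = (2 * Complex.I) • P (f 1) := by
        rw [hu, hv, Complex.conj_I, add_sub_add_left_eq_sub, ← sub_smul]
        congr 1
        ring
      have hmem : (2 * Complex.I)⁻¹ • (u - v) ∈ R := R.smul_mem _ (R.sub_mem huR hvR)
      rwa [hdiff, smul_smul, inv_mul_cancel₀ (by simp : (2 * Complex.I) ≠ 0), one_smul] at hmem
    have h0 : P (f 0) ∈ R := by
      have hmem : u - Complex.I • P (f 1) ∈ R := R.sub_mem huR (R.smul_mem _ h1)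
      rwa [hu, add_sub_cancel_right] at hmem
    rw [Submodule.map_le_iff_le_comap, Submodule.span_le, Set.range_subset_iff]
    intro i
    fin_cases i
    · exact h0
    · exact h1
  refine ⟨X, hX, A, Finset.univ.image f, ?_, ?_, ?_, ?_, ?_⟩
  -- rationality
  · intro c hc
    obtain ⟨i, -, rfl⟩ := Finset.mem_image.1 hc
    fin_cases i
    · simpa [hf8] using hrat.mem 8
    · simpa [hf9] using hrat.mem 9
  -- sub-Hodge
  · rw [hcoe]
    refine le_antisymm (key _ ?_ ?_) (iSup_le fun _ ↦ iSup_le fun _ ↦ iSup_le fun _ ↦ inf_le_left)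
    · exact Submodule.mem_iSup_of_mem 2 (Submodule.mem_iSup_of_mem 1
        (Submodule.mem_iSup_of_mem rfl ⟨huW, hu21⟩))
    · exact Submodule.mem_iSup_of_mem 1 (Submodule.mem_iSup_of_mem 2
        (Submodule.mem_iSup_of_mem rfl ⟨hvW, hv12⟩))
  -- level one
  · rw [hcoe]
    refine key _ ?_ ?_
    · exact Submodule.mem_iSup_of_mem 2 (Submodule.mem_iSup_of_mem 1 (Submodule.mem_iSup_of_mem rfl
        (Submodule.mem_iSup_of_mem (by norm_num) (Submodule.mem_iSup_of_mem le_rfl hu21))))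
    · exact Submodule.mem_iSup_of_mem 1 (Submodule.mem_iSup_of_mem 2 (Submodule.mem_iSup_of_mem rfl
        (Submodule.mem_iSup_of_mem le_rfl (Submodule.mem_iSup_of_mem (by norm_num) hv12))))
  -- `h^{3,0} = 1`
  · have hw : P (prodClass t fun _ ↦ Complex.I) ≠ 0 := by
      intro hw0
      have h := periodFunctional_prodClass (B := B) hB (conj Complex.I) (fun _ ↦ Complex.I)
      rw [← map_prodClass P t, hw0, map_zero, Finset.prod_const, Finset.card_univ, Fintype.card_fin,
        Complex.conj_I] at h
      have h2 : (-Complex.I - Complex.I) ^ 3 = 8 * Complex.I := by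
        have hI3 : Complex.I ^ 3 = -Complex.I := by
          rw [pow_succ, Complex.I_sq]; ring
        calc (-Complex.I - Complex.I) ^ 3 = ((-2) * Complex.I) ^ 3 := by ring
          _ = (-8) * Complex.I ^ 3 := by ring
          _ = 8 * Complex.I := by rw [hI3]; ring
      rw [h2] at h
      have h8 : (8 : ℂ) * Complex.I = 0 := by
        have := h.symm
        rwa [neg_eq_zero] at this
      exact Complex.I_ne_zero ((mul_eq_zero.1 h8).resolve_left (by norm_num))
    rw [h30, hP, finrank_span_singleton hw]
  -- rank two
  · rw [hcoe, finrank_span_eq_card hfli, Fintype.card_fin]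

/-- **Vacuity guard for both sides of the route**: the hypotheses of the positive crux
`LevelOneConiveauThreefolds` (GHC(3,1) for threefolds, stmt-HodgeConjecture-10376) and of its habitat
case `AttractorPlanesConiveauOne` (stmt-HodgeConjecture-10377) — a smooth projective threefold, a Hodge
model, a finite set of rational classes of `H³` spanning a sub-Hodge structure of level one (here of
rank `2`, with `h^{3,0} = 1`) — are instantiated NON-TRIVIALLY in the tree (the span is non-zero), so
neither the positive crux nor the negated statement inside `ConiveauOneFailure` is decided by an empty
or zero habitat. Immediate from `exists_levelOnePlane_calabiYauType_ellipticCurveCubed`.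
[cite: GrothendieckTopology1969, p. 300] -/
theorem exists_levelOnePlane_threefold_ne_bot :
    ∃ (Y : SchemeOver ℂ) (_ : IsSmoothProjective 3 Y) (A : HodgeModel 3 Y)
      (s : Finset (complexBetti Y 3)),
      (∀ c ∈ s, IsRationalClass c) ∧
      (Submodule.span ℂ (↑s : Set (complexBetti Y 3))).map (A.pullback 3).hom =
        (⨆ (p : ℕ) (q : ℕ) (_ : p + q = 3),
          (Submodule.span ℂ (↑s : Set (complexBetti Y 3))).map (A.pullback 3).hom ⊓
            A.hodgePQ 3 p q) ∧
      (Submodule.span ℂ (↑s : Set (complexBetti Y 3))).map (A.pullback 3).hom ≤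
        (⨆ (p : ℕ) (q : ℕ) (_ : p + q = 3) (_ : 1 ≤ p) (_ : 1 ≤ q), A.hodgePQ 3 p q) ∧
      Module.finrank ℂ (A.hodgePQ 3 3 0) = 1 ∧
      Submodule.span ℂ (↑s : Set (complexBetti Y 3)) ≠ ⊥ := by
  obtain ⟨Y, hY, A, s, hs, hsub, hlev, h30, hs2⟩ := exists_levelOnePlane_calabiYauType_ellipticCurveCubed
  refine ⟨Y, hY, A, s, hs, hsub, hlev, h30, fun hbot ↦ ?_⟩
  rw [hbot, finrank_bot] at hs2
  exact absurd hs2 (by norm_num)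

end Summit.HodgeConjecture.HodgeConjecture.Theorems

end
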